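import Literature.Probability.RandomPlanarGeometry.SAWDimensionGap
import Literature.Probability.RandomPlanarGeometry.SAWLowerBound25
import HarnessLib

/-!
# Certified lower bounds `μ(ℤ^d) ≥ d + 1/2` for every `d ≥ 2`

Topic `Literature/Probability/RandomPlanarGeometry` (corollaries of `SAWDimensionGap.lean` — the unit gap
`μ(ℤ^{d+1}) ≥ μ(ℤ^d) + 1` — and `SAWLowerBound25.lean` — the certified planar bound `5/2 ≤ μ(ℤ²)`, standard
axioms).

Bauerschmidt–Duminil-Copin–Goodman–Slade (2012), §1.3, eq. (1.13): "`dⁿ ≤ cₙ ≤ 2d(2d−1)^{n−1}` … which implies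
`d ≤ μ ≤ 2d − 1`". Transporting the planar certificate up the dimensions by the unit gap improves the elementary
lower bound `d ≤ μ(ℤ^d)` to **`d + 1/2 ≤ μ(ℤ^d)` for every `d ≥ 2`** (`nat_add_half_le_connectiveConstant`), e.g.
`7/2 ≤ μ(ℤ³)`, `9/2 ≤ μ(ℤ⁴)` (numerically `μ(ℤ³) = 4.684`, `μ(ℤ⁴) = 6.7720 ± 0.0005`, `μ(ℤ⁵) = 8.838`; Madras–Slade Table 1.1).
With the computational certificate `2.604 ≤ μ(ℤ²)` (`SAWLowerBound2604.lean`) the same argument gives `d + 0.604`;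
that edition is not stated here to keep this file on standard axioms.

Honest label: an ELEMENTARY all-`d` certificate, far below the printed fixed-`d` bounds (e.g. for `d = 3` the
printed enclosure is `4.43733 ≤ μ(ℤ³) ≤ 4.756`, Madras–Slade Table 1.1 (p. 12; Hara–Slade 1992, Alm 1992); Kesten's
expansion gives
`μ(ℤ^d) = 2d − 1 − 1/(2d) − …`); its only point is that the tree's lower bound for `d ≥ 3` is now better than the
textbook `d`. (Lane «pcv-sawmu»; the unit gap was first proved in the lane by a-p6, 2026-08-21, HOME
`SAWDimensionMonotonicity.lean`; tree file `SAWDimensionGap.lean`.)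
-/

noncomputable section

namespace Literature.Probability.RandomPlanarGeometry.SAW.Zd

/-- **`μ(ℤ^{d+2}) ≥ d + 5/2`**: the certified planar bound `5/2 ≤ μ(ℤ²)` transported up `d` dimensions by the unit
gap `μ(ℤ^{k+1}) ≥ μ(ℤ^k) + 1`. [cite: BDGS2012, §1.3, eq. (1.13)] [cite: Jensen2004SAWLowerBounds, §2, eq. (4)] -/
theorem nat_add_five_halves_le_connectiveConstant (d : ℕ) :
    (d : ℝ) + 5 / 2 ≤ connectiveConstant (d + 2) := by
  have h := connectiveConstant_add_nat_le 2 d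
  have h25 := le_connectiveConstant_two_25
  rw [show 2 + d = d + 2 by omega] at h
  linarith

/-- **`μ(ℤ^d) ≥ d + 1/2` for every `d ≥ 2`** — a certified improvement, in every dimension, of the elementary bound
`d ≤ μ(ℤ^d)` of (1.13). [cite: BDGS2012, §1.3, eq. (1.13)] [cite: Jensen2004SAWLowerBounds, §2, eq. (4)] -/
theorem nat_add_half_le_connectiveConstant {d : ℕ} (hd : 2 ≤ d) : (d : ℝ) + 1 / 2 ≤ connectiveConstant d := by
  obtain ⟨k, rfl⟩ : ∃ k, d = k + 2 := ⟨d - 2, by omega⟩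
  have := nat_add_five_halves_le_connectiveConstant k
  push_cast
  linarith

/-- `7/2 ≤ μ(ℤ³)` (numerically `μ(ℤ³) = 4.684`). [cite: BDGS2012, §1.3, eq. (1.13)] -/
theorem seven_halves_le_connectiveConstant_three : (7 / 2 : ℝ) ≤ connectiveConstant 3 := by
  have := nat_add_five_halves_le_connectiveConstant 1
  norm_num at this
  exact this

end Literature.Probability.RandomPlanarGeometry.SAW.Zd

end
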